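import Mathlib.Analysis.Calculus.InverseFunctionTheorem.FDeriv
import Mathlib.Analysis.Calculus.ContDiff.Operations
import Mathlib.Analysis.Calculus.Deriv.Slope
import Mathlib.Analysis.Calculus.Deriv.MeanValue
import Mathlib.Analysis.InnerProductSpace.Calculus
import Mathlib.Analysis.SpecialFunctions.SmoothTransition
import Mathlib.Analysis.SpecialFunctions.Sqrt
import Mathlib.Analysis.SpecialFunctions.Trigonometric.ArctanDeriv
import Mathlib.LinearAlgebra.FiniteDimensional.Lemmas
import Mathlib.Geometry.Manifold.LocalDiffeomorph
import HarnessLib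

/-!
# Radial maps with invertible derivative and smooth saturation profiles

Infrastructure (theorems only) for the connected-sum decomposition of surgery on a split link
(`Literature.Topology.FourManifolds.exists_isSurgery_zeroFramedUnlink`, `KirbyCalculus.lean`),
complementing the fixed-constant ball contraction / puncture expansion of `RadialDiffeomorph.lean`
(which this file does not import) by radial maps with *arbitrary* profiles and by the saturation
profile "identity near the origin, bounded far out":

* `exists_openPartialHomeomorph_of_forall_hasFDerivAt` — the global form of the inverse function
  theorem used throughout (the local chart form is `exists_openPartialHomeomorph_of_hasFDerivAt`
  of `SeamBicollar.lean`): a map which is `C^∞`, injective and has invertible derivative on an open set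
  `U` is an open partial homeomorphism with source `U`, open image and `C^∞` inverse on the image
  (Lee, *Introduction to Smooth Manifolds* (2013), Cor. 4.6 / Prop. 5.7), and the corresponding
  local-diffeomorphism statement for the model manifold structure
  (`isLocalDiffeomorphAt_of_contDiffOn_openPartialHomeomorph`).
* radial self-maps `v ↦ φ (‖v‖²) • v` of a real inner product space: smoothness, derivative
  `φ(‖v‖²) • id + 2 φ'(‖v‖²) ⟪v, ·⟫ v`, invertibility of the derivative when `φ ≠ 0` and
  `φ + 2 s φ' ≠ 0`, norm, injectivity and image for injective radial profiles `t ↦ t φ(t²)`.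
* smooth monotone profiles on the line: gluing two smooth increasing functions `h₁ ≤ h₂` across
  `[a, b]` with Mathlib's `Real.smoothTransition` (`exists_smooth_strictMono_blend`), and the
  saturation profile — identity up to `a`, increasing and bounded by `b`
  (`exists_saturationProfile`).

Everything here is elementary calculus; nothing is specific to dimension `3`. The file declares
no definitions (all statements are existential), so that its users stay in the proof lane.

## References

* J. M. Lee, *Introduction to Smooth Manifolds*, 2nd ed. (2013), Ch. 4 (inverse function
  theorem and its corollaries).
-/

open scoped Topology ContDiff RealInnerProductSpace Manifold
open Set Function Metric Filter

noncomputable section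

namespace Literature.Topology.FourManifolds

/-! ### The global inverse function theorem on an open set -/

section IFT

variable {E F : Type*} [NormedAddCommGroup E] [NormedSpace ℝ E] [CompleteSpace E]
  [NormedAddCommGroup F] [NormedSpace ℝ F]

/-- **Images of open sets under a map with invertible derivative are open** (inverse function
theorem, Lee (2013), Prop. 4.8 / Thm. 4.5). [folklore] -/
theorem isOpen_image_of_hasStrictFDerivAt_equiv {f : E → F} {U V : Set E} (hVU : V ⊆ U)
    (hV : IsOpen V)
    (hderiv : ∀ x ∈ U, ∃ f' : E ≃L[ℝ] F, HasStrictFDerivAt f (f' : E →L[ℝ] F) x) :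
    IsOpen (f '' V) := by
  rw [isOpen_iff_mem_nhds]
  rintro _ ⟨x, hx, rfl⟩
  obtain ⟨f', hf'⟩ := hderiv x (hVU hx)
  rw [← hf'.map_nhds_eq_of_equiv]
  exact Filter.image_mem_map (hV.mem_nhds hx)

omit [CompleteSpace E] in
/-- A `C^∞` map has a strict derivative at every point of an open set on which it is `C^∞`;
if moreover the derivative there is (pointwise) a continuous linear equivalence, so is the strict
derivative. [folklore] -/
theorem exists_hasStrictFDerivAt_equiv_of_contDiffOn {f : E → F} {U : Set E} (hU : IsOpen U)
    (hf : ContDiffOn ℝ ∞ f U)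
    (hderiv : ∀ x ∈ U, ∃ f' : E ≃L[ℝ] F, HasFDerivAt f (f' : E →L[ℝ] F) x) :
    ∀ x ∈ U, ∃ f' : E ≃L[ℝ] F, HasStrictFDerivAt f (f' : E →L[ℝ] F) x := by
  intro x hx
  obtain ⟨f', hf'⟩ := hderiv x hx
  have hstrict : HasStrictFDerivAt f (fderiv ℝ f x) x :=
    (hf.contDiffAt (hU.mem_nhds hx)).hasStrictFDerivAt (by simp)
  exact ⟨f', hf'.fderiv ▸ hstrict⟩

/-- **The inverse function theorem, global form on an open set.** Let `f : E → F` be `C^∞` and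
injective on the open set `U` of the nonempty space `E`, with derivative a continuous linear
equivalence at every point of `U`. Then there is an open partial homeomorphism `Φ` which is `f`
as a function, with source `U` and target the (open) image `f '' U`, whose inverse is `C^∞` on
`f '' U` (Lee (2013), Cor. 4.6, Prop. 5.7: an injective local diffeomorphism is a diffeomorphism
onto an open subset). [folklore] -/
theorem exists_openPartialHomeomorph_of_forall_hasFDerivAt [Nonempty E] {f : E → F} {U : Set E}
    (hU : IsOpen U) (hf : ContDiffOn ℝ ∞ f U) (hinj : InjOn f U)
    (hderiv : ∀ x ∈ U, ∃ f' : E ≃L[ℝ] F, HasFDerivAt f (f' : E →L[ℝ] F) x) :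
    ∃ Φ : OpenPartialHomeomorph E F, (⇑Φ = f) ∧ Φ.source = U ∧ Φ.target = f '' U ∧
      IsOpen (f '' U) ∧ ContDiffOn ℝ ∞ Φ.symm (f '' U) := by
  have hstrict := exists_hasStrictFDerivAt_equiv_of_contDiffOn hU hf hderiv
  set e : PartialEquiv E F := hinj.toPartialEquiv f U with he
  have hesrc : e.source = U := rfl
  have hecoe : (e : E → F) = f := rfl
  have hcont : ContinuousOn e e.source := hf.continuousOn
  have hopen : IsOpenMap (e.source.restrict e) := by
    intro s hs
    obtain ⟨t, ht, rfl⟩ := isOpen_induced_iff.1 hs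
    rw [hesrc, restrict_eq, image_comp, Subtype.image_preimage_coe, hecoe]
    exact isOpen_image_of_hasStrictFDerivAt_equiv inter_subset_left (hU.inter ht) hstrict
  set Φ := OpenPartialHomeomorph.ofContinuousOpenRestrict e hcont hopen hU with hΦ
  have hΦcoe : ⇑Φ = f := rfl
  have hΦsrc : Φ.source = U := rfl
  have hΦtgt : Φ.target = f '' U := rfl
  refine ⟨Φ, hΦcoe, hΦsrc, hΦtgt, hΦtgt ▸ Φ.open_target, fun y hy ↦ ?_⟩
  have hy' : y ∈ Φ.target := hy
  have hx : Φ.symm y ∈ U := hΦsrc ▸ Φ.map_target hy'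
  obtain ⟨f', hf'⟩ := hderiv _ hx
  exact (Φ.contDiffAt_symm hy' (by rw [hΦcoe]; exact hf')
    (by rw [hΦcoe]; exact hf.contDiffAt (hU.mem_nhds hx))).contDiffWithinAt

omit [CompleteSpace E] in
/-- **A map agreeing near `x` with a `C^∞` open partial homeomorphism with `C^∞` inverse is a
local diffeomorphism at `x`** for the model manifold structures `𝓘(ℝ, E)`, `𝓘(ℝ, F)` (the bridge
from the vector-space inverse function theorem to Mathlib's `IsLocalDiffeomorphAt`). [folklore] -/
theorem isLocalDiffeomorphAt_of_contDiffOn_openPartialHomeomorph {f : E → F} {x : E}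
    (Φ : OpenPartialHomeomorph E F) (hx : x ∈ Φ.source) (hΦ : ContDiffOn ℝ ∞ Φ Φ.source)
    (hΦ' : ContDiffOn ℝ ∞ Φ.symm Φ.target) (h : f =ᶠ[𝓝 x] Φ) :
    IsLocalDiffeomorphAt 𝓘(ℝ, E) 𝓘(ℝ, F) ∞ f x := by
  obtain ⟨t, ht, heq⟩ := Filter.eventuallyEq_iff_exists_mem.1 h
  obtain ⟨s, hst, hso, hxs⟩ := _root_.mem_nhds_iff.1 ht
  set Ψ := Φ.restrOpen s hso with hΨ
  refine ⟨⟨Ψ.toPartialEquiv, Ψ.open_source, Ψ.open_target, ?_, ?_⟩, ⟨hx, hxs⟩,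
    fun y hy ↦ heq (hst hy.2)⟩
  · exact (hΦ.mono inter_subset_left).contMDiffOn
  · exact (hΦ'.mono inter_subset_left).contMDiffOn

/-- **An injective `C^∞` map with invertible derivative on an open set is a local diffeomorphism
at each of its points** (model manifold structures). [folklore] -/
theorem isLocalDiffeomorphAt_of_hasFDerivAt [Nonempty E] {f : E → F} {U : Set E}
    (hU : IsOpen U) (hf : ContDiffOn ℝ ∞ f U) (hinj : InjOn f U)
    (hderiv : ∀ x ∈ U, ∃ f' : E ≃L[ℝ] F, HasFDerivAt f (f' : E →L[ℝ] F) x) {x : E} (hx : x ∈ U) :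
    IsLocalDiffeomorphAt 𝓘(ℝ, E) 𝓘(ℝ, F) ∞ f x := by
  obtain ⟨Φ, hΦf, hsrc, htgt, -, hsymm⟩ := exists_openPartialHomeomorph_of_forall_hasFDerivAt hU hf hinj
    hderiv
  refine isLocalDiffeomorphAt_of_contDiffOn_openPartialHomeomorph Φ (hsrc ▸ hx)
    (by rw [hΦf, hsrc]; exact hf) (by rw [htgt]; exact hsymm) (Filter.Eventually.of_forall ?_)
  intro y; rw [hΦf]

end IFT

/-! ### Radial maps `v ↦ φ (‖v‖²) • v` -/

section Radial

variable {E : Type*} [NormedAddCommGroup E] [InnerProductSpace ℝ E]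

/-- The norm of a radial map: `‖φ(‖v‖²) • v‖ = |φ (‖v‖²)| ‖v‖`. [folklore] -/
theorem norm_radial (φ : ℝ → ℝ) (v : E) : ‖φ (‖v‖ ^ 2) • v‖ = |φ (‖v‖ ^ 2)| * ‖v‖ := by
  rw [norm_smul, Real.norm_eq_abs]

/-- A radial map on a multiple of a unit vector: `φ(t²) t • u`. [folklore] -/
theorem radial_smul {φ : ℝ → ℝ} {u : E} (hu : ‖u‖ = 1) (t : ℝ) :
    φ (‖t • u‖ ^ 2) • (t • u) = (t * φ (t ^ 2)) • u := by
  rw [norm_smul, hu, mul_one, Real.norm_eq_abs, sq_abs, smul_smul, mul_comm]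

/-- A radial map with `C^∞` profile is `C^∞`. [folklore] -/
theorem contDiff_radial {φ : ℝ → ℝ} (hφ : ContDiff ℝ ∞ φ) :
    ContDiff ℝ ∞ (fun v : E ↦ φ (‖v‖ ^ 2) • v) :=
  (hφ.comp (contDiff_norm_sq ℝ)).smul contDiff_id

/-- A radial map whose profile is `C^∞` at `‖v‖²` is `C^∞` at `v`. [folklore] -/
theorem contDiffAt_radial {φ : ℝ → ℝ} {v : E} (hφ : ContDiffAt ℝ ∞ φ (‖v‖ ^ 2)) :
    ContDiffAt ℝ ∞ (fun v : E ↦ φ (‖v‖ ^ 2) • v) v :=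
  (hφ.comp v (contDiff_norm_sq ℝ).contDiffAt).smul contDiffAt_id

/-- The candidate derivative `c • id + (2 c') • ⟪v, ·⟫ v` of a radial map on a vector. [folklore] -/
theorem radialDeriv_apply (c c' : ℝ) (v x : E) :
    (c • ContinuousLinearMap.id ℝ E + (2 * c') • (innerSL ℝ v).smulRight v) x =
      c • x + (2 * c' * ⟪v, x⟫) • v := by
  change c • x + (2 * c') • (⟪v, x⟫ • v) = _
  rw [smul_smul]

/-- **The derivative of a radial map**: `x ↦ φ(‖v‖²) x + 2 φ'(‖v‖²) ⟪v, x⟫ v` wherever the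
profile is differentiable at the squared norm (chain rule with `d‖v‖² = 2⟪v, ·⟫`). [folklore] -/
theorem hasFDerivAt_radial {φ : ℝ → ℝ} {φ' : ℝ} {v : E} (hφ : HasDerivAt φ φ' (‖v‖ ^ 2)) :
    HasFDerivAt (fun v : E ↦ φ (‖v‖ ^ 2) • v)
      (φ (‖v‖ ^ 2) • ContinuousLinearMap.id ℝ E + (2 * φ') • (innerSL ℝ v).smulRight v) v := by
  have h1 : HasFDerivAt (fun w : E ↦ φ (‖w‖ ^ 2)) (φ' • ((2 : ℕ) • innerSL ℝ v)) v :=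
    hφ.comp_hasFDerivAt v (hasStrictFDerivAt_norm_sq v).hasFDerivAt
  have h2 := h1.smul (hasFDerivAt_id v)
  refine h2.congr_fderiv ?_
  ext x
  change φ (‖v‖ ^ 2) • x + (φ' • (((2 : ℕ) • innerSL ℝ v) x)) • v =
    (φ (‖v‖ ^ 2) • ContinuousLinearMap.id ℝ E + (2 * φ') • (innerSL ℝ v).smulRight v) x
  have hsc : φ' • (((2 : ℕ) • innerSL ℝ v) x) = 2 * φ' * ⟪v, x⟫ := by
    change φ' • ((2 : ℕ) • ⟪v, x⟫) = _
    rw [nsmul_eq_mul, smul_eq_mul, Nat.cast_ofNat]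
    ring
  rw [radialDeriv_apply, hsc]

/-- **The derivative of a radial map is injective** when `c = φ(s) ≠ 0` and
`c + 2 s c' ≠ 0` at `s = ‖v‖²` (its eigenvalues are `c` on `v⊥` and `c + 2 s c'` on `ℝ v`).
[folklore] -/
theorem radialDeriv_injective {c c' : ℝ} {v : E} (hc : c ≠ 0) (hrad : c + 2 * ‖v‖ ^ 2 * c' ≠ 0) :
    Injective (c • ContinuousLinearMap.id ℝ E + (2 * c') • (innerSL ℝ v).smulRight v) := by
  refine (injective_iff_map_eq_zero
    (c • ContinuousLinearMap.id ℝ E + (2 * c') • (innerSL ℝ v).smulRight v)).2 fun x hx ↦ ?_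
  rw [radialDeriv_apply] at hx
  -- take the inner product with `v`
  have h1 : ⟪v, c • x + (2 * c' * ⟪v, x⟫) • v⟫ = 0 := by rw [hx, inner_zero_right]
  rw [inner_add_right, inner_smul_right, inner_smul_right, real_inner_self_eq_norm_sq] at h1
  have h2 : ⟪v, x⟫ * (c + 2 * ‖v‖ ^ 2 * c') = 0 := by linear_combination h1
  have h3 : ⟪v, x⟫ = 0 := (mul_eq_zero.1 h2).resolve_right hrad
  rw [h3, mul_zero, zero_smul, add_zero] at hx
  exact (smul_eq_zero.1 hx).resolve_left hc

/-- **A radial map has invertible derivative** at `v` (finite dimension) when `φ(s) ≠ 0` and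
`φ(s) + 2 s φ'(s) ≠ 0`, `s = ‖v‖²`. [folklore] -/
theorem exists_hasFDerivAt_radial_equiv [FiniteDimensional ℝ E] {φ : ℝ → ℝ} {φ' : ℝ} {v : E}
    (hφ : HasDerivAt φ φ' (‖v‖ ^ 2)) (h0 : φ (‖v‖ ^ 2) ≠ 0)
    (hrad : φ (‖v‖ ^ 2) + 2 * ‖v‖ ^ 2 * φ' ≠ 0) :
    ∃ f' : E ≃L[ℝ] E, HasFDerivAt (fun v : E ↦ φ (‖v‖ ^ 2) • v) (f' : E →L[ℝ] E) v := by
  set L : E →L[ℝ] E :=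
    φ (‖v‖ ^ 2) • ContinuousLinearMap.id ℝ E + (2 * φ') • (innerSL ℝ v).smulRight v with hL
  refine ⟨((L : E →ₗ[ℝ] E).linearEquivOfInjective (radialDeriv_injective h0 hrad)
    rfl).toContinuousLinearEquiv, ?_⟩
  have hcoe : (((L : E →ₗ[ℝ] E).linearEquivOfInjective (radialDeriv_injective h0 hrad)
      rfl).toContinuousLinearEquiv : E →L[ℝ] E) = L := by
    ext x; rfl
  rw [hcoe]
  exact hasFDerivAt_radial hφ

/-- **Injectivity of a radial map**: if `φ (‖v‖²) > 0` on `U` and the radial profile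
`t ↦ t φ(t²)` is injective on a set of reals containing the norms of the points of `U`, then the
radial map is injective on `U`. [folklore] -/
theorem injOn_radial {φ : ℝ → ℝ} {U : Set E} {T : Set ℝ} (hT : ∀ v ∈ U, ‖v‖ ∈ T)
    (hpos : ∀ t ∈ T, 0 < φ (t ^ 2)) (hinj : InjOn (fun t ↦ t * φ (t ^ 2)) T) :
    InjOn (fun v : E ↦ φ (‖v‖ ^ 2) • v) U := by
  intro v hv w hw h
  have hn : ‖v‖ = ‖w‖ := by
    have h1 := congrArg norm h
    simp only at h1
    rw [norm_radial, norm_radial, abs_of_pos (hpos _ (hT v hv)),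
      abs_of_pos (hpos _ (hT w hw)), mul_comm, mul_comm (φ _)] at h1
    exact hinj (hT v hv) (hT w hw) h1
  simp only at h
  rw [hn] at h
  exact smul_right_injective E (hpos _ (hT w hw)).ne' h

/-- **The image of a radial map**: a vector of norm `t φ(t²)` with `t ≥ 0`, `φ(t²) > 0`, is the
image of a vector of norm `t`. [folklore] -/
theorem exists_radial_eq {φ : ℝ → ℝ} {t : ℝ} (ht : 0 ≤ t) (hpos : 0 < φ (t ^ 2)) {w : E}
    (hw : ‖w‖ = t * φ (t ^ 2)) : ∃ v : E, ‖v‖ = t ∧ φ (‖v‖ ^ 2) • v = w := by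
  rcases eq_or_lt_of_le ht with rfl | ht0
  · refine ⟨0, norm_zero, ?_⟩
    rw [zero_mul] at hw
    rw [smul_zero, eq_comm, ← norm_eq_zero, hw]
  have hw0 : 0 < ‖w‖ := by rw [hw]; positivity
  have hu : ‖‖w‖⁻¹ • w‖ = 1 := by
    rw [norm_smul, norm_inv, norm_norm, inv_mul_cancel₀ hw0.ne']
  refine ⟨t • ‖w‖⁻¹ • w, ?_, ?_⟩
  · rw [norm_smul, hu, mul_one, Real.norm_eq_abs, abs_of_pos ht0]
  · rw [radial_smul hu, smul_smul, ← hw, mul_inv_cancel₀ hw0.ne', one_smul]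

/-- The radial profile `t ↦ t φ(t²)` has derivative `φ(t²) + 2 t² φ'(t²)`. [folklore] -/
theorem hasDerivAt_radialProfile {φ : ℝ → ℝ} {φ' t : ℝ} (hφ : HasDerivAt φ φ' (t ^ 2)) :
    HasDerivAt (fun t : ℝ ↦ t * φ (t ^ 2)) (φ (t ^ 2) + 2 * t ^ 2 * φ') t := by
  have hsq : HasDerivAt (fun x : ℝ ↦ x ^ 2) (2 * t) t := by
    simpa using hasDerivAt_pow 2 t
  have h1 : HasDerivAt (fun t : ℝ ↦ φ (t ^ 2)) (φ' * (2 * t)) t :=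
    HasDerivAt.comp t (h₂ := φ) (h := fun x : ℝ ↦ x ^ 2) hφ hsq
  have h2 := (hasDerivAt_id t).mul h1
  refine h2.congr_deriv ?_
  simp only [id]; ring

/-- **A radial map of the whole space as an open partial homeomorphism with smooth inverse.**
Let the profile `φ` be `C^∞` at every `s ≥ 0`, with `φ(t²) > 0` and `φ(t²) + 2t² φ'(t²) > 0`
for `t ≥ 0` (the radial profile `t φ(t²)` is increasing). Then `v ↦ φ(‖v‖²) • v` is injective,
`C^∞`, with open range, and is an open partial homeomorphism of source the whole (finite
dimensional) space whose inverse is `C^∞` on the range. [folklore] -/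
theorem exists_openPartialHomeomorph_radial [FiniteDimensional ℝ E] {φ : ℝ → ℝ}
    (hφ : ∀ s, 0 ≤ s → ContDiffAt ℝ ∞ φ s) (hpos : ∀ t, 0 ≤ t → 0 < φ (t ^ 2))
    (hder : ∀ t, 0 ≤ t → 0 < φ (t ^ 2) + 2 * t ^ 2 * deriv φ (t ^ 2)) :
    Injective (fun v : E ↦ φ (‖v‖ ^ 2) • v) ∧ ContDiff ℝ ∞ (fun v : E ↦ φ (‖v‖ ^ 2) • v) ∧
    ∃ Φ : OpenPartialHomeomorph E E, (⇑Φ = fun v : E ↦ φ (‖v‖ ^ 2) • v) ∧ Φ.source = univ ∧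
      Φ.target = range (fun v : E ↦ φ (‖v‖ ^ 2) • v) ∧
      IsOpen (range (fun v : E ↦ φ (‖v‖ ^ 2) • v)) ∧
      ContDiffOn ℝ ∞ Φ.symm (range (fun v : E ↦ φ (‖v‖ ^ 2) • v)) := by
  haveI : Nonempty E := ⟨0⟩
  have hdiff : ∀ t, 0 ≤ t → HasDerivAt φ (deriv φ (t ^ 2)) (t ^ 2) := fun t ht ↦
    ((hφ _ (sq_nonneg t)).differentiableAt (by simp)).hasDerivAt
  -- the radial profile is strictly increasing on `[0, ∞)`
  have hmono : StrictMonoOn (fun t : ℝ ↦ t * φ (t ^ 2)) (Ici 0) := by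
    refine strictMonoOn_of_deriv_pos (convex_Ici 0) ?_ fun t ht ↦ ?_
    · exact fun t ht ↦ ((hasDerivAt_radialProfile (hdiff t ht)).continuousAt).continuousWithinAt
    · rw [interior_Ici] at ht
      rw [(hasDerivAt_radialProfile (hdiff t ht.le)).deriv]
      exact hder t ht.le
  have hinj : InjOn (fun v : E ↦ φ (‖v‖ ^ 2) • v) univ :=
    injOn_radial (T := Ici 0) (fun v _ ↦ norm_nonneg v) (fun t ht ↦ hpos t ht) hmono.injOn
  have hsmooth : ContDiff ℝ ∞ (fun v : E ↦ φ (‖v‖ ^ 2) • v) :=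
    contDiff_iff_contDiffAt.2 fun v ↦ contDiffAt_radial (hφ _ (sq_nonneg _))
  have hderiv : ∀ v ∈ (univ : Set E), ∃ f' : E ≃L[ℝ] E,
      HasFDerivAt (fun v : E ↦ φ (‖v‖ ^ 2) • v) (f' : E →L[ℝ] E) v := fun v _ ↦
    exists_hasFDerivAt_radial_equiv (hdiff _ (norm_nonneg v)) (hpos _ (norm_nonneg v)).ne'
      (hder _ (norm_nonneg v)).ne'
  obtain ⟨Φ, hΦf, hsrc, htgt, hopen, hsymm⟩ :=
    exists_openPartialHomeomorph_of_forall_hasFDerivAt isOpen_univ hsmooth.contDiffOn hinj hderiv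
  rw [image_univ] at htgt hopen hsymm
  exact ⟨injOn_univ.1 hinj, hsmooth, Φ, hΦf, hsrc, htgt, hopen, hsymm⟩

/-- **A radial map of the punctured space as an open partial homeomorphism with smooth inverse.**
Let the profile `φ` be `C^∞` at every `s > 0`, with `φ(t²) > 0`, `φ(t²) + 2t² φ'(t²) ≠ 0` for
`t > 0` and injective radial profile `t φ(t²)` on `(0, ∞)`. Then `v ↦ φ(‖v‖²) • v` is injective
and `C^∞` on `{0}ᶜ`, with open image of `{0}ᶜ`, and is an open partial homeomorphism of source
`{0}ᶜ` whose inverse is `C^∞` on that image. [folklore] -/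
theorem exists_openPartialHomeomorph_radial_punctured [FiniteDimensional ℝ E] {φ : ℝ → ℝ}
    (hφ : ∀ s, 0 < s → ContDiffAt ℝ ∞ φ s) (hpos : ∀ t, 0 < t → 0 < φ (t ^ 2))
    (hder : ∀ t, 0 < t → φ (t ^ 2) + 2 * t ^ 2 * deriv φ (t ^ 2) ≠ 0)
    (hinjφ : InjOn (fun t : ℝ ↦ t * φ (t ^ 2)) (Ioi 0)) :
    InjOn (fun v : E ↦ φ (‖v‖ ^ 2) • v) {0}ᶜ ∧
    ContDiffOn ℝ ∞ (fun v : E ↦ φ (‖v‖ ^ 2) • v) {0}ᶜ ∧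
    ∃ Φ : OpenPartialHomeomorph E E, (⇑Φ = fun v : E ↦ φ (‖v‖ ^ 2) • v) ∧ Φ.source = {0}ᶜ ∧
      Φ.target = (fun v : E ↦ φ (‖v‖ ^ 2) • v) '' {0}ᶜ ∧
      IsOpen ((fun v : E ↦ φ (‖v‖ ^ 2) • v) '' {0}ᶜ) ∧
      ContDiffOn ℝ ∞ Φ.symm ((fun v : E ↦ φ (‖v‖ ^ 2) • v) '' {0}ᶜ) := by
  haveI : Nonempty E := ⟨0⟩
  have hn : ∀ v ∈ ({0}ᶜ : Set E), 0 < ‖v‖ := fun v hv ↦ norm_pos_iff.2 hv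
  have hdiff : ∀ t, 0 < t → HasDerivAt φ (deriv φ (t ^ 2)) (t ^ 2) := fun t ht ↦
    ((hφ _ (by positivity)).differentiableAt (by simp)).hasDerivAt
  have hinj : InjOn (fun v : E ↦ φ (‖v‖ ^ 2) • v) {0}ᶜ :=
    injOn_radial (T := Ioi 0) hn (fun t ht ↦ hpos t ht) hinjφ
  have hsmooth : ContDiffOn ℝ ∞ (fun v : E ↦ φ (‖v‖ ^ 2) • v) {0}ᶜ := fun v hv ↦
    (contDiffAt_radial (hφ _ (by have := hn v hv; positivity))).contDiffWithinAt
  have hderiv : ∀ v ∈ ({0}ᶜ : Set E), ∃ f' : E ≃L[ℝ] E,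
      HasFDerivAt (fun v : E ↦ φ (‖v‖ ^ 2) • v) (f' : E →L[ℝ] E) v := fun v hv ↦
    exists_hasFDerivAt_radial_equiv (hdiff _ (hn v hv)) (hpos _ (hn v hv)).ne' (hder _ (hn v hv))
  obtain ⟨Φ, hΦf, hsrc, htgt, hopen, hsymm⟩ :=
    exists_openPartialHomeomorph_of_forall_hasFDerivAt isOpen_compl_singleton hsmooth hinj hderiv
  exact ⟨hinj, hsmooth, Φ, hΦf, hsrc, htgt, hopen, hsymm⟩

end Radial

/-! ### Smooth monotone profiles on the line -/

section Profiles

variable {a b : ℝ} {h₁ h₂ : ℝ → ℝ}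

/-- **Blending two increasing functions.** Let `a < b` and let `h₁`, `h₂` be smooth with
`h₁' > 0` on `(-∞, b]`, `h₂' > 0` on `[a, ∞)` and `h₁ ≤ h₂` on `[a, b]`. Then there is a smooth
function `g` with everywhere positive derivative (hence strictly increasing), equal to `h₁` on
`(-∞, a]`, to `h₂` on `[b, ∞)`, and squeezed between `h₁` and `h₂` on `[a, b]`: the convex
combination `(1 - χ) h₁ + χ h₂` with `χ x = smoothTransition ((x - a)/(b - a))`
(Mathlib's `Real.smoothTransition`), whose derivative
`(1 - χ) h₁' + χ h₂' + χ' (h₂ - h₁)` is positive. [folklore] -/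
theorem exists_smooth_strictMono_blend (hab : a < b) (hh₁ : ContDiff ℝ ∞ h₁)
    (hh₂ : ContDiff ℝ ∞ h₂) (hd₁ : ∀ x, x ≤ b → 0 < deriv h₁ x)
    (hd₂ : ∀ x, a ≤ x → 0 < deriv h₂ x) (hle : ∀ x ∈ Icc a b, h₁ x ≤ h₂ x) :
    ∃ g : ℝ → ℝ, ContDiff ℝ ∞ g ∧ (∀ x, 0 < deriv g x) ∧ StrictMono g ∧
      (∀ x, x ≤ a → g x = h₁ x) ∧ (∀ x, b ≤ x → g x = h₂ x) ∧
      (∀ x ∈ Icc a b, h₁ x ≤ g x ∧ g x ≤ h₂ x) := by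
  -- the transition weight and its properties
  set χ : ℝ → ℝ := fun x ↦ Real.smoothTransition ((x - a) / (b - a)) with hχ
  have hχs : ContDiff ℝ ∞ χ :=
    Real.smoothTransition.contDiff.comp ((contDiff_id.sub contDiff_const).div_const _)
  have hχ0 : ∀ x, x ≤ a → χ x = 0 := fun x hx ↦
    Real.smoothTransition.zero_of_nonpos (div_nonpos_of_nonpos_of_nonneg (by linarith) (by linarith))
  have hχ1 : ∀ x, b ≤ x → χ x = 1 := fun x hx ↦
    Real.smoothTransition.one_of_one_le ((one_le_div (by linarith)).2 (by linarith))
  have hχnn : ∀ x, 0 ≤ χ x := fun x ↦ Real.smoothTransition.nonneg _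
  have hχle : ∀ x, χ x ≤ 1 := fun x ↦ Real.smoothTransition.le_one _
  have hχmono : Monotone χ := fun x y hxy ↦
    Real.smoothTransition.monotone (div_le_div_of_nonneg_right (by linarith) (by linarith))
  have hχd : ∀ x, 0 ≤ deriv χ x := fun x ↦ hχmono.deriv_nonneg
  -- the blend
  set g : ℝ → ℝ := fun x ↦ (1 - χ x) * h₁ x + χ x * h₂ x with hg
  have hg₁ : ∀ x, x ≤ a → g x = h₁ x := fun x hx ↦ by simp only [hg, hχ0 x hx]; ring
  have hg₂ : ∀ x, b ≤ x → g x = h₂ x := fun x hx ↦ by simp only [hg, hχ1 x hx]; ring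
  have hgs : ContDiff ℝ ∞ g := ((contDiff_const.sub hχs).mul hh₁).add (hχs.mul hh₂)
  have hderiv : ∀ x, HasDerivAt g ((1 - χ x) * deriv h₁ x + χ x * deriv h₂ x +
      deriv χ x * (h₂ x - h₁ x)) x := fun x ↦ by
    have hχx : HasDerivAt χ (deriv χ x) x :=
      (hχs.differentiable (by simp)).differentiableAt.hasDerivAt
    have hh₁x : HasDerivAt h₁ (deriv h₁ x) x :=
      (hh₁.differentiable (by simp)).differentiableAt.hasDerivAt
    have hh₂x : HasDerivAt h₂ (deriv h₂ x) x :=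
      (hh₂.differentiable (by simp)).differentiableAt.hasDerivAt
    have h := (((hasDerivAt_const x (1 : ℝ)).sub hχx).mul hh₁x).add (hχx.mul hh₂x)
    exact h.congr_deriv (by simp only [Pi.sub_apply]; ring)
  have hpos : ∀ x, 0 < deriv g x := by
    intro x
    rcases lt_or_ge x a with hxa | hxa
    · have heq : g =ᶠ[𝓝 x] h₁ :=
        Filter.eventually_of_mem (Iio_mem_nhds hxa) fun y hy ↦ hg₁ y (le_of_lt hy)
      rw [heq.deriv_eq]
      exact hd₁ x (by linarith)
    rcases lt_or_ge b x with hxb | hxb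
    · have heq : g =ᶠ[𝓝 x] h₂ :=
        Filter.eventually_of_mem (Ioi_mem_nhds hxb) fun y hy ↦ hg₂ y (le_of_lt hy)
      rw [heq.deriv_eq]
      exact hd₂ x hxa
    · rw [(hderiv x).deriv]
      have h0 := hχnn x
      have h1 := hχle x
      have h3 : 0 ≤ h₂ x - h₁ x := sub_nonneg.2 (hle x ⟨hxa, hxb⟩)
      have h4 := hd₁ x hxb
      have h5 := hd₂ x hxa
      have h6 : 0 ≤ deriv χ x * (h₂ x - h₁ x) := mul_nonneg (hχd x) h3
      rcases le_total (deriv h₁ x) (deriv h₂ x) with hd | hd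
      · have h7 : 0 ≤ χ x * (deriv h₂ x - deriv h₁ x) := mul_nonneg h0 (sub_nonneg.2 hd)
        nlinarith
      · have h7 : 0 ≤ (1 - χ x) * (deriv h₁ x - deriv h₂ x) :=
          mul_nonneg (sub_nonneg.2 h1) (sub_nonneg.2 hd)
        nlinarith
  refine ⟨g, hgs, hpos, strictMono_of_deriv_pos hpos, hg₁, hg₂, fun x hx ↦ ?_⟩
  have h3 := hle x hx
  have h0 := hχnn x
  have h1 := hχle x
  constructor
  · simp only [hg]; nlinarith
  · simp only [hg]; nlinarith

/-- **The saturation profile.** For `a < b` there is a smooth strictly increasing function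
`ℓ : ℝ → ℝ` with everywhere positive derivative which is the identity on `(-∞, a]`, bounded
above by `b`, and `≥ a` on `[a, ∞)`: blend the identity into the bounded increasing tail
`x ↦ (a + b)/2 + ((b - a)/2π) arctan (x - a)` across `[a, (a + b)/2]`. Used to restrict
embeddings of a vector space (or of a fibre) to a bounded region without changing them near the
origin. [folklore] -/
theorem exists_saturationProfile (hab : a < b) :
    ∃ ℓ : ℝ → ℝ, ContDiff ℝ ∞ ℓ ∧ (∀ x, 0 < deriv ℓ x) ∧ StrictMono ℓ ∧
      (∀ x, x ≤ a → ℓ x = x) ∧ (∀ x, ℓ x < b) ∧ (∀ x, a ≤ x → a ≤ ℓ x) := by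
  set m : ℝ := (a + b) / 2 with hm
  set c : ℝ := (b - a) / (2 * Real.pi) with hc
  have hπ := Real.pi_pos
  have hba : 0 < b - a := by linarith
  have hc0 : 0 < c := by positivity
  set T : ℝ → ℝ := fun x ↦ m + c * Real.arctan (x - a) with hT
  have hTs : ContDiff ℝ ∞ T :=
    contDiff_const.add (contDiff_const.mul (Real.contDiff_arctan.comp (contDiff_id.sub contDiff_const)))
  have hTd : ∀ x, HasDerivAt T (c * (1 / (1 + (x - a) ^ 2))) x := fun x ↦ by
    have h := ((Real.hasDerivAt_arctan (x - a)).comp x ((hasDerivAt_id x).sub_const a)).const_mul c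
    rw [mul_one] at h
    exact h.const_add _
  have hTd' : ∀ x, 0 < deriv T x := fun x ↦ by
    rw [(hTd x).deriv]; positivity
  have hTlt : ∀ x, T x < b := fun x ↦ by
    have h1 := Real.arctan_lt_pi_div_two (x - a)
    have h2 : c * Real.arctan (x - a) < c * (Real.pi / 2) := mul_lt_mul_of_pos_left h1 hc0
    have h3 : c * (Real.pi / 2) = (b - a) / 4 := by rw [hc]; field_simp; ring
    simp only [hT]; linarith
  have hTge : ∀ x, a ≤ x → m ≤ T x := fun x hx ↦ by
    have h1 : 0 ≤ Real.arctan (x - a) := Real.arctan_nonneg.2 (by linarith)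
    have : 0 ≤ c * Real.arctan (x - a) := by positivity
    simp only [hT]; linarith
  have ham : a < m := by rw [hm]; linarith
  obtain ⟨ℓ, hℓs, hℓd, hℓmono, hℓ₁, hℓ₂, hℓ₃⟩ := exists_smooth_strictMono_blend ham contDiff_id hTs
    (fun x _ ↦ by rw [deriv_id]; exact one_pos) (fun x _ ↦ hTd' x)
    (fun x hx ↦ by simp only [id]; exact le_trans hx.2 (hTge x hx.1))
  refine ⟨ℓ, hℓs, hℓd, hℓmono, fun x hx ↦ hℓ₁ x hx, fun x ↦ ?_, fun x hx ↦ ?_⟩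
  · rcases le_or_gt x a with hx | hx
    · rw [hℓ₁ x hx]; simp only [id]; linarith
    rcases le_or_gt x m with hx' | hx'
    · exact (hℓ₃ x ⟨hx.le, hx'⟩).2.trans_lt (hTlt x)
    · rw [hℓ₂ x hx'.le]; exact hTlt x
  · have h := hℓmono.monotone hx
    rw [hℓ₁ a le_rfl] at h
    exact h

end Profiles

end Literature.Topology.FourManifolds
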